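import Summits.CriticalPhenomena.SAWScalingLimit.Theorems.SAWWeldingIdentificationWeldingLawOfLimitStableNecessity

/-!
# Proxy-free form of Stub A `StableChordProxies` (crux `WeldingLawOfLimit`, stmt-4502)

Route `SAWWeldingIdentification` of `CriticalPhenomena/SAWScalingLimit`, crux (W)
`WeldingLawOfLimit` (stmt-CriticalPhenomena-4502), line `registered` = skeleton
`Cruxes/WeldingLawOfLimit/Lines/stable_proxies.lean` (lead c12; computation by stub-worker A).
Stub A asks for chord proxies `cₙ ω` of the critical `ℤ²` SAW (eventually a.s. simple chords of
`(Ω; a, b) = Q.chord 0 2`, close to the walk in probability) whose canonical welding is STABLE in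
probability, uniformly in the mesh. This file shows that no choice of proxies makes the stability
clause cheap: **Stub A ⟺ (I1) ∧ (I2)** (`stableChordProxies_iff_chordProxies_and_walkWeldingOsc`)
with two statements about the WALK ALONE —

* (I1) chord proxies exist (simple chords close to the walk in probability; in the tree only under
  stmt-1372 ∧ stmt-4982, `chordProxies_of_eventualTight_of_simpleSubseqLimits`; unconditionally
  it needs a no-return estimate at the two marked points plus plane topology of the polyline), and
* (I2) the welding OSCILLATION AT THE WALK is small in probability, uniformly in the mesh:
  `∀ x ε η > 0 ∃ ρ > 0, ∀ᶠ n, P_δₙ {ω | ∃ simple chords γ₁ γ₂ within ρ of ω.curve,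
  ε ≤ |h γ₁ x - h γ₂ x|} ≤ η` (expected engine: a Beurling-type projection bound for the two banks
  plus diffuseness of the harmonic coordinates of gates under the SAW law — not in the tree).

The two fixed-family lemmas are triangle inequalities in `CurveClass ℂ` and in `ℝ` with union
bounds. All statements are the skeleton's, unfolded. No new definition, no named fact.
-/

noncomputable section

open MeasureTheory Filter Topology Set
open scoped NNReal BoundedContinuousFunction
open Literature.Probability.RandomPlanarGeometry Literature.Probability.LatticeModels
open Summit.CriticalPhenomena.SAWScalingLimit.Theses

namespace Summit.CriticalPhenomena.SAWScalingLimit.Theorems.WeldingLawOfLimit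

section Fixed

variable {Q : ConformalRectangle} {δs : ℕ → ℝ} {a b : ℝ → Site 2}
  {c : (n : ℕ) → SAW.DomainSAW Q.carrier (δs n) (a (δs n)) (b (δs n)) → CurveClass ℂ}

/-- Proxies close to the walk + small walk welding oscillation ⇒ the proxies are welding-stable
(triangle inequality: a simple chord `ρ/2`-close to `cₙ ω`, itself `ρ/2`-close to the walk, is
`ρ`-close to the walk). [folklore] -/
theorem isWeldingStable_of_walkOsc
    (hc1 : ∀ᶠ n in atTop, ∀ᵐ ω ∂(SAW.law Q.carrier (δs n) (a (δs n)) (b (δs n))),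
        (Q.chord 0 2 (by decide)).IsSimpleChord (c n ω))
    (hc2 : ∀ ε : ℝ, 0 < ε →
        Tendsto (fun n => (SAW.law Q.carrier (δs n) (a (δs n)) (b (δs n))).real
          {ω | ε < dist ω.curve (c n ω)}) atTop (𝓝 0))
    (hW : ∀ x : ℝ, 0 < x → ∀ ε : ℝ, 0 < ε → ∀ η : ℝ, 0 < η → ∃ ρ : ℝ, 0 < ρ ∧
      ∀ᶠ n in atTop, (SAW.law Q.carrier (δs n) (a (δs n)) (b (δs n))).real
        {ω | ∃ γ₁ γ₂ : CurveClass ℂ, (Q.chord 0 2 (by decide)).IsSimpleChord γ₁ ∧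
          (Q.chord 0 2 (by decide)).IsSimpleChord γ₂ ∧
          dist γ₁ ω.curve < ρ ∧ dist γ₂ ω.curve < ρ ∧
          ε ≤ |conformalWelding Q γ₁ x - conformalWelding Q γ₂ x|} ≤ η) :
    ∀ x : ℝ, 0 < x → ∀ ε : ℝ, 0 < ε → ∀ η : ℝ, 0 < η → ∃ ρ : ℝ, 0 < ρ ∧
      ∀ᶠ n in atTop, (SAW.law Q.carrier (δs n) (a (δs n)) (b (δs n))).real
        {ω | ∃ γ' : CurveClass ℂ, (Q.chord 0 2 (by decide)).IsSimpleChord γ' ∧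
          dist γ' (c n ω) < ρ ∧
          ε ≤ |conformalWelding Q γ' x - conformalWelding Q (c n ω) x|} ≤ η := by
  intro x hx ε hε η hη
  obtain ⟨ρ₀, hρ₀, hbad⟩ := hW x hx ε hε (η / 2) (by positivity)
  refine ⟨ρ₀ / 2, by positivity, ?_⟩
  have h2 := hc2 (ρ₀ / 2) (by positivity)
  rw [Metric.tendsto_nhds] at h2
  filter_upwards [hbad, h2 (η / 2) (by positivity), hc1] with n hbadn h2n hchn
  set μ : Measure (SAW.DomainSAW Q.carrier (δs n) (a (δs n)) (b (δs n))) :=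
    SAW.law Q.carrier (δs n) (a (δs n)) (b (δs n)) with hμ
  haveI : IsFiniteMeasure μ := isFiniteMeasure_sawLaw _ _ _ _
  set T := {ω : SAW.DomainSAW Q.carrier (δs n) (a (δs n)) (b (δs n)) |
      ∃ γ' : CurveClass ℂ, (Q.chord 0 2 (by decide)).IsSimpleChord γ' ∧
        dist γ' (c n ω) < ρ₀ / 2 ∧
        ε ≤ |conformalWelding Q γ' x - conformalWelding Q (c n ω) x|} with hT
  set E := {ω : SAW.DomainSAW Q.carrier (δs n) (a (δs n)) (b (δs n)) |
      ∃ γ₁ γ₂ : CurveClass ℂ, (Q.chord 0 2 (by decide)).IsSimpleChord γ₁ ∧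
        (Q.chord 0 2 (by decide)).IsSimpleChord γ₂ ∧
        dist γ₁ ω.curve < ρ₀ ∧ dist γ₂ ω.curve < ρ₀ ∧
        ε ≤ |conformalWelding Q γ₁ x - conformalWelding Q γ₂ x|} with hE
  set A := {ω : SAW.DomainSAW Q.carrier (δs n) (a (δs n)) (b (δs n)) |
      ρ₀ / 2 < dist ω.curve (c n ω)} with hA
  set N := {ω : SAW.DomainSAW Q.carrier (δs n) (a (δs n)) (b (δs n)) |
      ¬ (Q.chord 0 2 (by decide)).IsSimpleChord (c n ω)} with hN
  have hsub : T ⊆ (E ∪ A) ∪ N := by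
    rintro ω ⟨γ', hγ', hd, hle⟩
    by_cases hch : (Q.chord 0 2 (by decide)).IsSimpleChord (c n ω)
    · by_cases hA' : ρ₀ / 2 < dist ω.curve (c n ω)
      · exact Or.inl (Or.inr hA')
      · have hdω : dist ω.curve (c n ω) ≤ ρ₀ / 2 := not_lt.1 hA'
        refine Or.inl (Or.inl ⟨γ', c n ω, hγ', hch, ?_, ?_, hle⟩)
        · calc dist γ' ω.curve ≤ dist γ' (c n ω) + dist (c n ω) ω.curve := dist_triangle _ _ _
            _ < ρ₀ / 2 + ρ₀ / 2 := by
                rw [dist_comm (c n ω)]; exact add_lt_add_of_lt_of_le hd hdω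
            _ = ρ₀ := by ring
        · rw [dist_comm]; linarith
    · exact Or.inr hch
  have hN0 : μ.real N = 0 := by
    have h0 : μ N = 0 := ae_iff.1 hchn
    rw [measureReal_def, h0, ENNReal.toReal_zero]
  have hA1 : μ.real A < η / 2 := by
    have := h2n
    rwa [Real.dist_eq, sub_zero, abs_of_nonneg measureReal_nonneg] at this
  have hmono : μ.real T ≤ μ.real ((E ∪ A) ∪ N) := measureReal_mono hsub
  have hu1 : μ.real ((E ∪ A) ∪ N) ≤ μ.real (E ∪ A) + μ.real N := measureReal_union_le _ _
  have hu2 : μ.real (E ∪ A) ≤ μ.real E + μ.real A := measureReal_union_le _ _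
  have hE' : μ.real E ≤ η / 2 := hbadn
  linarith

/-- Welding-stable proxies close to the walk ⇒ small walk welding oscillation (two chords
`ρ/2`-close to the walk are `ρ`-close to `cₙ ω`; one of them is `ε/2`-far from it in `h`).
[folklore] -/
theorem walkOsc_of_isWeldingStable
    (hc2 : ∀ ε : ℝ, 0 < ε →
        Tendsto (fun n => (SAW.law Q.carrier (δs n) (a (δs n)) (b (δs n))).real
          {ω | ε < dist ω.curve (c n ω)}) atTop (𝓝 0))
    (hst : ∀ x : ℝ, 0 < x → ∀ ε : ℝ, 0 < ε → ∀ η : ℝ, 0 < η → ∃ ρ : ℝ, 0 < ρ ∧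
      ∀ᶠ n in atTop, (SAW.law Q.carrier (δs n) (a (δs n)) (b (δs n))).real
        {ω | ∃ γ' : CurveClass ℂ, (Q.chord 0 2 (by decide)).IsSimpleChord γ' ∧
          dist γ' (c n ω) < ρ ∧
          ε ≤ |conformalWelding Q γ' x - conformalWelding Q (c n ω) x|} ≤ η) :
    ∀ x : ℝ, 0 < x → ∀ ε : ℝ, 0 < ε → ∀ η : ℝ, 0 < η → ∃ ρ : ℝ, 0 < ρ ∧
      ∀ᶠ n in atTop, (SAW.law Q.carrier (δs n) (a (δs n)) (b (δs n))).real
        {ω | ∃ γ₁ γ₂ : CurveClass ℂ, (Q.chord 0 2 (by decide)).IsSimpleChord γ₁ ∧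
          (Q.chord 0 2 (by decide)).IsSimpleChord γ₂ ∧
          dist γ₁ ω.curve < ρ ∧ dist γ₂ ω.curve < ρ ∧
          ε ≤ |conformalWelding Q γ₁ x - conformalWelding Q γ₂ x|} ≤ η := by
  intro x hx ε hε η hη
  obtain ⟨ρ₀, hρ₀, hbad⟩ := hst x hx (ε / 2) (by positivity) (η / 2) (by positivity)
  refine ⟨ρ₀ / 2, by positivity, ?_⟩
  have h2 := hc2 (ρ₀ / 2) (by positivity)
  rw [Metric.tendsto_nhds] at h2
  filter_upwards [hbad, h2 (η / 2) (by positivity)] with n hbadn h2n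
  set μ : Measure (SAW.DomainSAW Q.carrier (δs n) (a (δs n)) (b (δs n))) :=
    SAW.law Q.carrier (δs n) (a (δs n)) (b (δs n)) with hμ
  haveI : IsFiniteMeasure μ := isFiniteMeasure_sawLaw _ _ _ _
  set E := {ω : SAW.DomainSAW Q.carrier (δs n) (a (δs n)) (b (δs n)) |
      ∃ γ₁ γ₂ : CurveClass ℂ, (Q.chord 0 2 (by decide)).IsSimpleChord γ₁ ∧
        (Q.chord 0 2 (by decide)).IsSimpleChord γ₂ ∧
        dist γ₁ ω.curve < ρ₀ / 2 ∧ dist γ₂ ω.curve < ρ₀ / 2 ∧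
        ε ≤ |conformalWelding Q γ₁ x - conformalWelding Q γ₂ x|} with hE
  set B := {ω : SAW.DomainSAW Q.carrier (δs n) (a (δs n)) (b (δs n)) |
      ∃ γ' : CurveClass ℂ, (Q.chord 0 2 (by decide)).IsSimpleChord γ' ∧
        dist γ' (c n ω) < ρ₀ ∧
        ε / 2 ≤ |conformalWelding Q γ' x - conformalWelding Q (c n ω) x|} with hB
  set A := {ω : SAW.DomainSAW Q.carrier (δs n) (a (δs n)) (b (δs n)) |
      ρ₀ / 2 < dist ω.curve (c n ω)} with hA
  have hsub : E ⊆ B ∪ A := by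
    rintro ω ⟨γ₁, γ₂, h₁, h₂, hd₁, hd₂, hle⟩
    by_cases hA' : ρ₀ / 2 < dist ω.curve (c n ω)
    · exact Or.inr hA'
    · left
      have hdω : dist ω.curve (c n ω) ≤ ρ₀ / 2 := not_lt.1 hA'
      have hd₁' : dist γ₁ (c n ω) < ρ₀ := by
        calc dist γ₁ (c n ω) ≤ dist γ₁ ω.curve + dist ω.curve (c n ω) := dist_triangle _ _ _
          _ < ρ₀ / 2 + ρ₀ / 2 := add_lt_add_of_lt_of_le hd₁ hdω
          _ = ρ₀ := by ring
      have hd₂' : dist γ₂ (c n ω) < ρ₀ := by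
        calc dist γ₂ (c n ω) ≤ dist γ₂ ω.curve + dist ω.curve (c n ω) := dist_triangle _ _ _
          _ < ρ₀ / 2 + ρ₀ / 2 := add_lt_add_of_lt_of_le hd₂ hdω
          _ = ρ₀ := by ring
      by_cases hγ₁ : ε / 2 ≤ |conformalWelding Q γ₁ x - conformalWelding Q (c n ω) x|
      · exact ⟨γ₁, h₁, hd₁', hγ₁⟩
      · refine ⟨γ₂, h₂, hd₂', ?_⟩
        have hlt : |conformalWelding Q γ₁ x - conformalWelding Q (c n ω) x| < ε / 2 :=
          not_le.1 hγ₁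
        have htri : |conformalWelding Q γ₁ x - conformalWelding Q γ₂ x| ≤
            |conformalWelding Q γ₁ x - conformalWelding Q (c n ω) x| +
            |conformalWelding Q (c n ω) x - conformalWelding Q γ₂ x| := abs_sub_le _ _ _
        rw [abs_sub_comm (conformalWelding Q (c n ω) x)] at htri
        linarith
  have hA1 : μ.real A < η / 2 := by
    have := h2n
    rwa [Real.dist_eq, sub_zero, abs_of_nonneg measureReal_nonneg] at this
  have hmono : μ.real E ≤ μ.real (B ∪ A) := measureReal_mono hsub
  have hu : μ.real (B ∪ A) ≤ μ.real B + μ.real A := measureReal_union_le _ _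
  have hB' : μ.real B ≤ η / 2 := hbadn
  linarith

end Fixed

/-- **Stub A ⟺ (I1) chord proxies exist ∧ (I2) the walk's welding oscillation is small in
probability** (registered sub-goal; Stub A verbatim on the left). (⇒) drop stability for (I1);
(I2) from stability of the proxies and their closeness to the walk (`walkOsc_of_isWeldingStable`).
(⇐) the (I1)-proxies are stable by (I2) (`isWeldingStable_of_walkOsc`). [folklore] -/
theorem stableChordProxies_iff_chordProxies_and_walkWeldingOsc :
    (∀ (Q : ConformalRectangle) (a b : ℝ → Site 2),
      SAW.IsEndpointApprox (Q.chord 0 2 (by decide)) a b →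
      ∀ (δs : ℕ → ℝ), (∀ n, 0 < δs n) → Tendsto δs atTop (𝓝 0) →
      ∃ c : (n : ℕ) → SAW.DomainSAW Q.carrier (δs n) (a (δs n)) (b (δs n)) → CurveClass ℂ,
        ((∀ᶠ n in atTop, ∀ᵐ ω ∂(SAW.law Q.carrier (δs n) (a (δs n)) (b (δs n))),
            (Q.chord 0 2 (by decide)).IsSimpleChord (c n ω)) ∧
         (∀ ε : ℝ, 0 < ε →
            Tendsto (fun n => (SAW.law Q.carrier (δs n) (a (δs n)) (b (δs n))).real
              {ω | ε < dist ω.curve (c n ω)}) atTop (𝓝 0))) ∧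
        (∀ x : ℝ, 0 < x → ∀ ε : ℝ, 0 < ε → ∀ η : ℝ, 0 < η → ∃ ρ : ℝ, 0 < ρ ∧
          ∀ᶠ n in atTop, (SAW.law Q.carrier (δs n) (a (δs n)) (b (δs n))).real
            {ω | ∃ γ' : CurveClass ℂ, (Q.chord 0 2 (by decide)).IsSimpleChord γ' ∧
              dist γ' (c n ω) < ρ ∧
              ε ≤ |conformalWelding Q γ' x - conformalWelding Q (c n ω) x|} ≤ η)) ↔
    ((∀ (Q : ConformalRectangle) (a b : ℝ → Site 2),
      SAW.IsEndpointApprox (Q.chord 0 2 (by decide)) a b →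
      ∀ (δs : ℕ → ℝ), (∀ n, 0 < δs n) → Tendsto δs atTop (𝓝 0) →
      ∃ c : (n : ℕ) → SAW.DomainSAW Q.carrier (δs n) (a (δs n)) (b (δs n)) → CurveClass ℂ,
        (∀ᶠ n in atTop, ∀ᵐ ω ∂(SAW.law Q.carrier (δs n) (a (δs n)) (b (δs n))),
          (Q.chord 0 2 (by decide)).IsSimpleChord (c n ω)) ∧
        (∀ ε : ℝ, 0 < ε →
          Tendsto (fun n => (SAW.law Q.carrier (δs n) (a (δs n)) (b (δs n))).real
            {ω | ε < dist ω.curve (c n ω)}) atTop (𝓝 0))) ∧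
     (∀ (Q : ConformalRectangle) (a b : ℝ → Site 2),
      SAW.IsEndpointApprox (Q.chord 0 2 (by decide)) a b →
      ∀ (δs : ℕ → ℝ), (∀ n, 0 < δs n) → Tendsto δs atTop (𝓝 0) →
      ∀ x : ℝ, 0 < x → ∀ ε : ℝ, 0 < ε → ∀ η : ℝ, 0 < η → ∃ ρ : ℝ, 0 < ρ ∧
        ∀ᶠ n in atTop, (SAW.law Q.carrier (δs n) (a (δs n)) (b (δs n))).real
          {ω | ∃ γ₁ γ₂ : CurveClass ℂ, (Q.chord 0 2 (by decide)).IsSimpleChord γ₁ ∧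
            (Q.chord 0 2 (by decide)).IsSimpleChord γ₂ ∧
            dist γ₁ ω.curve < ρ ∧ dist γ₂ ω.curve < ρ ∧
            ε ≤ |conformalWelding Q γ₁ x - conformalWelding Q γ₂ x|} ≤ η)) := by
  -- adapted from stub-worker A's scratch (lead c12 session)
  constructor
  · intro hA
    refine ⟨fun Q a b hab δs hpos hδ => ?_, fun Q a b hab δs hpos hδ => ?_⟩
    · obtain ⟨c, hc, -⟩ := hA Q a b hab δs hpos hδ
      exact ⟨c, hc.1, hc.2⟩
    · obtain ⟨c, hc, hst⟩ := hA Q a b hab δs hpos hδ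
      exact walkOsc_of_isWeldingStable hc.2 hst
  · rintro ⟨hP, hW⟩ Q a b hab δs hpos hδ
    obtain ⟨c, hc1, hc2⟩ := hP Q a b hab δs hpos hδ
    exact ⟨c, ⟨hc1, hc2⟩, isWeldingStable_of_walkOsc hc1 hc2 (hW Q a b hab δs hpos hδ)⟩

end Summit.CriticalPhenomena.SAWScalingLimit.Theorems.WeldingLawOfLimit

end
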